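import Literature.IUT.LogThetaLattice.PacketLogVolumesHaarModel
import Literature.IUT.LogVolume.PrincipalArithmeticDivisors
import HarnessLib

/-!
# [IUTchIII] Prop 3.9 (iii) at the genuine Haar model, RELATIVE case `K ⊋ F_mod` (|A| = 1): the local
# summands `K_w` pulled back along `F_mod ↪ K`, their moduli and Remark 3.1.1 (ii)'s weights — the local
# identities (row REL39, part R1)

S. Mochizuki, *Inter-universal Teichmüller theory III*, kurims manuscript (May 2020), §3, Proposition 3.9
(i)/(iii) pp. 115–117 and Remark 3.1.1 (ii) p. 94 [claim: Mochizuki2012, status: disputed] (lit key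
`paper:url-4b091feeb646`). Remark 3.1.1 (ii), p. 94: the normalized weight of the summand `K_v` of a log-shell
packet is "`1/([K_v : (F_mod)_v]·(Σ_{𝕍_mod ∋ w | v_ℚ} [(F_mod)_w : ℚ_{v_ℚ}]))`"; Prop 3.9 (iii) p. 117: the global
log-volume "is invariant with respect to multiplication by elements of `(†𝕄⊛_mod)_α = (†𝕄⊛_MOD)_α`".

WHY THIS FILE. abc-iut-L6-d3's `PacketLogVolumesHaarModel.lean` (p415871) builds the GENUINE model in the case
`K = F_mod = F` (`PlaceHaarDatum`, `archDatum`, `nonarchDatum`, `placeDatum`, `haarWeight`, the product formula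
`finsum_logModulus_eq_zero`, `prop39iii_invariance_haarModel`) and records under HONEST SCOPE (1): "for a general
`K ⊋ F_mod` the summand is `K_v`, `mod_{K_v}(f) = ‖f‖_{(F_mod)_v}^{[K_v:(F_mod)_v]}` for `f ∈ F_mod`, and the exponent
cancels the factor `[K_v:(F_mod)_v]^{-1}` of the printed weight — the same computation, not typed here." THIS
FILE types exactly that computation at the FINITE places (row REL39 of plan/L6/DISCHARGE-L6, part R1-nonarch =
the shared definitions on all places + the local identities at finite places):

* `PlaceHaarDatum.comap` — pull-back of a place datum of `K` along a field homomorphism `φ : F → K` (same summand,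
  same volume; `f ∈ F` acts and is measured through `φ f`); the one law `μ(f·T) = ‖f‖·μ(T)` transports;
* `relPlaceDatum F K w` — the summand `K_w` of the relative 1-packet at a place `w` of `K`, as an `F`-datum
  (`= (placeDatum K w).comap (algebraMap F K)`: `K_w` with its Haar volume at finite `w`, `ℂ` with the radial
  volume at archimedean `w`, `f ∈ F_mod` acting through `F_mod ↪ K ↪ K_w`);
* `relLocalDegree F K w` — the local degree `[K_w : F_v]`, `v` the place of `F` under `w`, AS THE NUMBER
  `e(w|v)·f(w|v)` at finite `w` (fundamental local identity) and `m_w ∈ {1, 2}` at archimedean `w` (campaign-S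
  `pullbackWeight`); `relHaarWeight F K w` — Remark 3.1.1 (ii)'s weight `1/([K_w:F_v]·[F:ℚ])` at finite `w`, and at
  archimedean `w` the same weight times the packet-normalisation factor `[K_w:ℝ]` of Prop 3.9 (i) p. 116 (as in
  p415871's `haarWeight`), i.e. `[K_w:ℝ]/([K_w:F_v]·[F:ℚ]) = [F_v:ℝ]/[F:ℚ]`;
* **`log_modulus_relPlaceDatum_inr`** — (a) `log ‖f‖_{K_w} = [K_w:F_v] · log ‖f‖_{F_v}` for `f ∈ F^×`, `w` finite
  (campaign-S `ord_algebraMap`: `ord_w(f) = e·ord_v(f)`, `logNorm_eq_inertiaDeg_mul`: `log q_w = f·log q_v`,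
  `log_adicAbv_eq_neg_deg`: `log‖x‖ = −ord(x)·log q`);
* **`relHaarWeight_mul_log_modulus_inr`** — (b) THE CANCELLATION at a finite `w | v`, `f ∈ F^×`:
  `relHaarWeight(w) · log ‖f‖_{K_w} = haarWeight_F(v) · log ‖f‖_v = (1/[F:ℚ])·log ‖f‖_v` (the term of p415871's
  product formula at `v`).
SPLIT OF THE ROW (L6-lead §F v1.19c): R1-arch (archimedean analogue, `…RelLocalArch.lean`), R2 (section-indexed
assembly + `Prop39iii_invariance`, `…Relative.lean`), R3 (|A| ≥ 2 + degree, `…RelativeTensor.lean`) are separate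
files by their holders, importing this one BY NAME.

HONEST SCOPE. |A| = 1; regions/volumes are p415871's (all positive-finite-volume subsets); the archimedean summand
is `ℂ` at every archimedean `w` as in p415871 (3); `[K_w:F_v]` enters as the number `e(w|v)f(w|v)` resp. `m_w` —
its identification with `finrank F_v K_w` is the fundamental local identity (tree: abc-iut-L6-t16
`finrank_place_eq_ramificationIdx_mul_inertiaDeg`, CompletionLocalDegree.lean), not re-proved here. Classical
mathematics (valuations in extensions + the product formula); nothing here constructs `(†𝓕⊛_mod)_α`, asserts
anything about [IUTchIII] Cor. 3.12, or takes a side; typed ≠ endorsed.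
-/

noncomputable section

namespace Literature.IUT.LogThetaLattice

open Literature.IUT.LogVolume NumberField IsDedekindDomain
open scoped ENNReal NNReal

/-! ### Pull-back of a place datum along a field homomorphism -/

namespace PlaceHaarDatum

variable {F K : Type} [Field F] [Field K]

/-- **Pull-back of a place datum of `K` along `φ : F → K`** (for `F_mod ↪ K`, [IUTchIII] Rmk 3.1.1 (ii) / Prop 3.9
(iii): `f ∈ F_mod` acts on the summand `K_v` through `F_mod ↪ K ↪ K_v` and is measured by `‖φ f‖_{K_v}`): same
summand, same volume, action and modulus precomposed with `φ`; the law `μ(f·T) = ‖f‖·μ(T)` transports since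
`φ f ≠ 0` for `f ≠ 0`. [claim: Mochizuki2012, status: disputed] -/
def comap (D : PlaceHaarDatum K) (φ : F →+* K) : PlaceHaarDatum F where
  X := D.X
  vol := D.vol
  act f := D.act (φ f)
  modulus f := D.modulus (φ f)
  modulus_pos hf := D.modulus_pos ((map_ne_zero φ).2 hf)
  vol_act hf T := D.vol_act ((map_ne_zero φ).2 hf) T

variable (D : PlaceHaarDatum K) (φ : F →+* K)

/-- The summand of the pull-back is the summand of `D`. [claim: Mochizuki2012, status: disputed] -/
theorem comap_X : (D.comap φ).X = D.X := rfl

/-- The modulus of the pull-back is `f ↦ ‖φ f‖`. [claim: Mochizuki2012, status: disputed] -/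
@[simp] theorem comap_modulus (f : F) : (D.comap φ).modulus f = D.modulus (φ f) := rfl

/-- The action of the pull-back is `f ↦ (φ f)·(−)`. [claim: Mochizuki2012, status: disputed] -/
@[simp] theorem comap_act (f : F) (T : Set D.X) : (D.comap φ).act f T = D.act (φ f) T := rfl

/-- The volume (hence admissibility and log-volumes) of the pull-back is that of `D`.
[claim: Mochizuki2012, status: disputed] -/
@[simp] theorem comap_vol (T : Set D.X) : (D.comap φ).vol T = D.vol T := rfl

/-- Log-volumes are unchanged by pull-back. [claim: Mochizuki2012, status: disputed] -/
theorem comap_logVol (T : Set D.X) : (D.comap φ).logVol T = D.logVol T := rfl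

end PlaceHaarDatum

variable (F K : Type) [Field F] [NumberField F] [Field K] [NumberField K] [Algebra F K]

/-! ### The relative summands `K_w`, `w ∈ 𝕍(K)`, as `F_mod`-data -/

/-- **The summand of the RELATIVE 1-packet at a place `w` of `K`** ([IUTchIII] Prop 3.9 (i)/(iii) with Rmk 3.1.1
(ii), `K ⊋ F_mod`): `K_w` with its Haar volume (finite `w`) resp. `ℂ` with the radial volume (archimedean `w`) —
abc-iut-L6-d3's `placeDatum K w` — on which `f ∈ F_mod = F` acts through `F ↪ K ↪ K_w`.
[claim: Mochizuki2012, status: disputed] -/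
def relPlaceDatum (w : Place K) : PlaceHaarDatum F := (placeDatum K w).comap (algebraMap F K)

omit [NumberField F] in
/-- At an archimedean `w` the modulus of `f ∈ F` is `|σ_w(f)| = w(f)`. [claim: Mochizuki2012, status: disputed] -/
@[simp] theorem relPlaceDatum_modulus_inl (w : InfinitePlace K) (f : F) :
    (relPlaceDatum F K (Sum.inl w)).modulus f = w (algebraMap F K f) := rfl

omit [NumberField F] in
/-- At a finite `w` the modulus of `f ∈ F` is `‖f‖_{K_w}` (Mathlib `adicAbv K w`). [claim: Mochizuki2012, status: disputed] -/
@[simp] theorem relPlaceDatum_modulus_inr (w : HeightOneSpectrum (𝓞 K)) (f : F) :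
    (relPlaceDatum F K (Sum.inr w)).modulus f = NumberField.HeightOneSpectrum.adicAbv K w (algebraMap F K f) :=
  rfl

/-! ### Local degrees and the weights of Remark 3.1.1 (ii) -/

/-- **The local degree `[K_w : F_v]`** of the summand `K_w` over the completion of `F` under it, AS A NUMBER:
`e(w|v)·f(w|v)` at a finite `w` (fundamental local identity `[K_w:F_v] = e·f`, tree: abc-iut-L6-t16
`finrank_place_eq_ramificationIdx_mul_inertiaDeg`), and `m_w ∈ {1, 2}` at an archimedean `w` (campaign-S
`pullbackWeight`: `1` if `w/v` is unramified, `2` if `v` is real and `w` complex). Remark 3.1.1 (ii) p. 94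
"`[K_v : (F_mod)_v]`". [claim: Mochizuki2012, status: disputed] -/
def relLocalDegree : Place K → ℕ
  | Sum.inl w => pullbackWeight F K (Sum.inl w)
  | Sum.inr w => Ideal.ramificationIdx' (finBelow F K w).asIdeal w.asIdeal *
      Ideal.inertiaDeg' (finBelow F K w).asIdeal w.asIdeal

omit [NumberField F] [NumberField K] in
/-- `[K_w:F_v] = e·f` at a finite `w` (definitional form). [claim: Mochizuki2012, status: disputed] -/
theorem relLocalDegree_inr (w : HeightOneSpectrum (𝓞 K)) :
    relLocalDegree F K (Sum.inr w) = Ideal.ramificationIdx' (finBelow F K w).asIdeal w.asIdeal *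
      Ideal.inertiaDeg' (finBelow F K w).asIdeal w.asIdeal := rfl

omit [NumberField F] [NumberField K] in
/-- `[K_w:F_v] = m_w` at an archimedean `w` (definitional form). [claim: Mochizuki2012, status: disputed] -/
theorem relLocalDegree_inl (w : InfinitePlace K) :
    relLocalDegree F K (Sum.inl w) = pullbackWeight F K (Sum.inl w) := rfl

/-- Local degrees are positive. [claim: Mochizuki2012, status: disputed] -/
theorem relLocalDegree_pos (w : Place K) : 0 < relLocalDegree F K w := by
  rcases w with w | w
  · rw [relLocalDegree_inl, pullbackWeight]
    split_ifs <;> norm_num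
  · rw [relLocalDegree_inr]
    haveI : (finBelow F K w).asIdeal.IsMaximal := (finBelow F K w).isMaximal
    haveI : w.asIdeal.IsPrime := w.isPrime
    refine Nat.mul_pos (Nat.pos_of_ne_zero ?_) (Nat.pos_of_ne_zero ?_)
    · exact Ideal.IsDedekindDomain.ramificationIdx'_ne_zero_of_liesOver w.asIdeal (finBelow F K w).ne_bot
    · exact Ideal.inertiaDeg'_ne_zero (finBelow F K w).asIdeal w.asIdeal

/-- **The weight of the summand `K_w`** ([IUTchIII] Rmk 3.1.1 (ii) p. 94 "`1/([K_v:(F_mod)_v]·Σ_{w|v_ℚ}[(F_mod)_w:ℚ_{v_ℚ}])`",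
with `Σ_{w|v_ℚ}[(F_mod)_w:ℚ_{v_ℚ}] = [F_mod:ℚ]`): `1/([K_w:F_v]·[F:ℚ])` at a finite `w`; at an archimedean `w` the
same weight times the packet-normalisation factor `[K_w:ℝ]` of Prop 3.9 (i) p. 116 (exactly as abc-iut-L6-d3's
`haarWeight` does for `K = F`), i.e. `[K_w:ℝ]/([K_w:F_v]·[F:ℚ])`. [claim: Mochizuki2012, status: disputed] -/
def relHaarWeight : Place K → ℝ
  | Sum.inl w => (w.mult : ℝ) / (relLocalDegree F K (Sum.inl w) * Module.finrank ℚ F)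
  | Sum.inr w => 1 / (relLocalDegree F K (Sum.inr w) * Module.finrank ℚ F)

omit [NumberField K] in
/-- `relHaarWeight (inl w) = [K_w:ℝ]/([K_w:F_v]·[F:ℚ])`. [claim: Mochizuki2012, status: disputed] -/
theorem relHaarWeight_inl (w : InfinitePlace K) :
    relHaarWeight F K (Sum.inl w) = (w.mult : ℝ) / (relLocalDegree F K (Sum.inl w) * Module.finrank ℚ F) := rfl

omit [NumberField K] in
/-- `relHaarWeight (inr w) = 1/([K_w:F_v]·[F:ℚ])`. [claim: Mochizuki2012, status: disputed] -/
theorem relHaarWeight_inr (w : HeightOneSpectrum (𝓞 K)) :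
    relHaarWeight F K (Sum.inr w) = 1 / (relLocalDegree F K (Sum.inr w) * Module.finrank ℚ F) := rfl

/-- All relative weights are positive. [claim: Mochizuki2012, status: disputed] -/
theorem relHaarWeight_pos (w : Place K) : 0 < relHaarWeight F K w := by
  have hd : (0 : ℝ) < Module.finrank ℚ F := FinDivisor.finrank_pos (F := F)
  rcases w with w | w
  · rw [relHaarWeight_inl]
    exact div_pos (by exact_mod_cast InfinitePlace.mult_pos)
      (mul_pos (by exact_mod_cast relLocalDegree_pos F K (Sum.inl w)) hd)
  · rw [relHaarWeight_inr]
    exact div_pos one_pos (mul_pos (by exact_mod_cast relLocalDegree_pos F K (Sum.inr w)) hd)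

/-! ### The local identities -/

/-- **`log ‖f‖_{K_w} = [K_w:F_v]·log ‖f‖_{F_v}`** for `f ∈ F^×` at a finite place `w | v` (abc-iut-L6-d3's HONEST
SCOPE (1) "`mod_{K_v}(f) = ‖f‖_{(F_mod)_v}^{[K_v:(F_mod)_v]}`", in logarithms): `ord_w(f) = e·ord_v(f)` (campaign-S
`ord_algebraMap`), `log q_w = f·log q_v` (`logNorm_eq_inertiaDeg_mul`), `log ‖x‖ = −ord(x)·log q`
(`log_adicAbv_eq_neg_deg`). [claim: Mochizuki2012, status: disputed] -/
theorem log_modulus_relPlaceDatum_inr (w : HeightOneSpectrum (𝓞 K)) {f : F} (hf : f ≠ 0) :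
    Real.log ((relPlaceDatum F K (Sum.inr w)).modulus f) =
      relLocalDegree F K (Sum.inr w) *
        Real.log ((placeDatum F (Sum.inr (finBelow F K w))).modulus f) := by
  have hf' : algebraMap F K f ≠ 0 := (map_ne_zero (algebraMap F K)).2 hf
  rw [relPlaceDatum_modulus_inr, placeDatum_inr, nonarchDatum_modulus, log_adicAbv_eq_neg_deg K w hf',
    log_adicAbv_eq_neg_deg F (finBelow F K w) hf, FinDivisor.deg_of, FinDivisor.deg_of, ord_algebraMap F K w f,
    logNorm_eq_inertiaDeg_mul (F := F) w, relLocalDegree_inr]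
  push_cast
  ring

/-- **THE CANCELLATION of Remark 3.1.1 (ii)'s weight against the exponent `[K_w:F_v]`** at a finite place
`w | v` and `f ∈ F^×`: `relHaarWeight(w)·log ‖f‖_{K_w} = haarWeight_F(v)·log ‖f‖_v = (1/[F:ℚ])·log ‖f‖_v` — the
relative summand contributes exactly the term of the ABSOLUTE model's product formula at the place below
(abc-iut-L6-d3's HONEST SCOPE (1): "the exponent cancels the factor `[K_v:(F_mod)_v]^{-1}` of the printed weight").
The archimedean analogue (`w | v` via `InfinitePlace.comap`: modulus `w (algebraMap f) = v f`, weight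
`[K_w:ℝ]/([K_w:F_v]·[F:ℚ]) = [F_v:ℝ]/[F:ℚ]` by campaign-S `pullbackWeight_mul_mult_comap`) is part R1-arch of the
row (separate file), and the section-indexed sum `= 0` (p415871 `finsum_logModulus_eq_zero F`) is part R2.
[claim: Mochizuki2012, status: disputed] -/
theorem relHaarWeight_mul_log_modulus_inr (w : HeightOneSpectrum (𝓞 K)) (f : Fˣ) :
    relHaarWeight F K (Sum.inr w) * Real.log ((relPlaceDatum F K (Sum.inr w)).modulus (f : F)) =
      haarWeight F (Sum.inr (finBelow F K w)) *
        Real.log ((placeDatum F (Sum.inr (finBelow F K w))).modulus (f : F)) := by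
  have hpos : (0 : ℝ) < relLocalDegree F K (Sum.inr w) := by exact_mod_cast relLocalDegree_pos F K (Sum.inr w)
  have hd : (0 : ℝ) < Module.finrank ℚ F := FinDivisor.finrank_pos (F := F)
  rw [log_modulus_relPlaceDatum_inr F K w f.ne_zero, relHaarWeight_inr, haarWeight_inr]
  field_simp

/-- The same with the place below written as `Place.below` (the form the assembly sums over).
[claim: Mochizuki2012, status: disputed] -/
theorem relHaarWeight_mul_log_modulus_inr' (w : HeightOneSpectrum (𝓞 K)) (f : Fˣ) :
    relHaarWeight F K (Sum.inr w) * Real.log ((relPlaceDatum F K (Sum.inr w)).modulus (f : F)) =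
      haarWeight F (Place.below F K (Sum.inr w)) *
        Real.log ((placeDatum F (Place.below F K (Sum.inr w))).modulus (f : F)) :=
  relHaarWeight_mul_log_modulus_inr F K w f

/-- In particular the finite-place relative term is `(1/[F:ℚ])·log ‖f‖_v` (the printed normalized contribution of
`v` to the product formula). [claim: Mochizuki2012, status: disputed] -/
theorem relHaarWeight_mul_log_modulus_inr_eq (w : HeightOneSpectrum (𝓞 K)) (f : Fˣ) :
    relHaarWeight F K (Sum.inr w) * Real.log ((relPlaceDatum F K (Sum.inr w)).modulus (f : F)) =
      (1 / Module.finrank ℚ F) *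
        Real.log (NumberField.HeightOneSpectrum.adicAbv F (finBelow F K w) (f : F)) := by
  rw [relHaarWeight_mul_log_modulus_inr, haarWeight_inr, placeDatum_inr, nonarchDatum_modulus]

end Literature.IUT.LogThetaLattice

end
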